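import Summits.QuantumFields.BalabanUV.T4Continuum.Support.NE7MinActHessianFlatCurl
import HarnessLib

/-!
# NE7SecondVariationHess — DICTIONARY: THE FRÉCHET HESSIAN OF THE WILSON ACTION IN THE EXPONENTIAL CHART AT ANY CONFIGURATION IS NE3's MIXED HESSIAN FORM `hess`
# (ROAD-G115 §6 (vii): the `𝒜`-term of the bordered Hessian ✓ `NE7MinActHessianLagrangian` in the tree's Hessian currency)

For every configuration `U`, window `W` and skew periodic-box field `X`: `D²(fineAction ∘ chart_U)(0)[X, X] = hess U (chartDir X) (chartDir X) W` (**`second_variation`**) — so the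
quantity `w·D²𝒜(0)[X,X]` minimised in ✓ `NE7MinActHessianLagrangian.minAct_hessian_lagrangian_of_lift` ∕ `…AllData` is `w·hess U♯ X̃ X̃ W` with `X̃ = chartDir X`, the object of row NE3's
Hessian calculus (✓ `NE3HessForm`, `NE3HessBounds`, the (ML_w) coercivity programme); at `U = 1` this is ✓ `NE7MinActHessianFlatCurl.flat_second_variation`.
MECHANISM: ✓ `NE3HessForm.hasDerivAt_fineAction_vary_at` ∕ `hasDerivAt_dAction_vary_at` along `t ↦ chart_U(tX) = U·e^{tX̃}` (`chart_smul`), the CLM second-order chain rule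
✓ `fderiv_fderiv_comp_clm`, and the bridge ✓ `fderiv_fderiv_one_one`.
Cell `pub-balaban`, rung (B)+1 sub-cell t4, lineage `b2b-balaban-t4-ne7-p1` (CRUX PROVER NE7 #1 = OWNER of BINDER row NE7), generation 115.  Memo `t4/b2b-balaban-t4-ne7-p1-g115/ROAD-G115.md` §6.
WHAT ([folklore]; 0 def, 0 sorry).  HONEST FRAMING (page 1): a dictionary identity; nothing of Bałaban's asserted; NOT NE7, NOT NE3; spine 0∕9; NOT infinite volume, NOT mass gap, NOT BetaPertH,
NOT Clay.
-/

set_option autoImplicit false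

open scoped BigOperators Matrix Matrix.Norms.L2Operator Topology
open NormedSpace Finset Set Filter Metric

namespace Summit.QuantumFields.BalabanUV.T4Continuum.NE7SecondVariationHess

open Literature.MathematicalPhysics.QuantumFieldTheory.Balaban1983to89
open B7Prop1Explicit B7Prop2Explicit
open T4AveragingDeficitWall (fineAction vary vary_zero)
open AveragingDeficitTorusChart (TDir chart chartDir chart_smul)
open AveragingDeficitChartCalculus (contDiffAt_fineAction_chart)
open AveragingDeficitTwoLevelPrep (skewSub)
open NE3HessForm (dAction hess hasDerivAt_fineAction_vary_at hasDerivAt_dAction_vary_at)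
open NE7SecondOrderChainRule (fderiv_fderiv_comp_clm)
open NE7MinActHessianFlatCurl (fderiv_fderiv_one_one)

noncomputable section

variable {n : Type} [Fintype n] [DecidableEq n]

/-- **THE FRÉCHET HESSIAN OF THE CHART ACTION IS NE3's `hess` FORM**: `D²(fineAction ∘ chart_U)(0)[X, X] = hess U (chartDir X) (chartDir X) W`. [folklore] -/
theorem second_variation [Nonempty n] {M : ℕ} [NeZero M] (U : Site 4 → Fin 4 → (Matrix n n ℂ)ˣ) (W : Finset (T4AveragingDeficitWall.Plaq 4)) (X : ↥(skewSub 4 n M)) :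
    fderiv ℝ (fderiv ℝ (fun Φ : ↥(skewSub 4 n M) => fineAction (chart (ContinuousLinearMap.id ℝ (Matrix n n ℂ)) M U (Φ : TDir 4 n M)) W)) 0 X X
      = hess U (chartDir (ContinuousLinearMap.id ℝ (Matrix n n ℂ)) M (X : TDir 4 n M)) (chartDir (ContinuousLinearMap.id ℝ (Matrix n n ℂ)) M (X : TDir 4 n M)) W := by
  set A : ↥(skewSub 4 n M) → ℝ := fun Φ => fineAction (chart (ContinuousLinearMap.id ℝ (Matrix n n ℂ)) M U (Φ : TDir 4 n M)) W with hA
  set Y : Site 4 → Fin 4 → Matrix n n ℂ := chartDir (ContinuousLinearMap.id ℝ (Matrix n n ℂ)) M (X : TDir 4 n M) with hY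
  set ℓ : ℝ →L[ℝ] ↥(skewSub 4 n M) := ContinuousLinearMap.toSpanSingleton ℝ X with hℓ
  have hψ : (fun t : ℝ => A (ℓ t)) = fun t : ℝ => fineAction (vary U Y t) W := by
    funext t
    simp only [hA, hℓ, ContinuousLinearMap.toSpanSingleton_apply, Submodule.coe_smul, chart_smul, hY]
  have hd1 : deriv (fun t : ℝ => A (ℓ t)) = fun t : ℝ => dAction (vary U Y t) Y W := by
    rw [hψ]; funext t; exact (hasDerivAt_fineAction_vary_at U Y W t).deriv
  have hd2 : deriv (deriv (fun t : ℝ => A (ℓ t))) 0 = hess U Y Y W := by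
    rw [hd1, (hasDerivAt_dAction_vary_at U Y W 0).deriv, vary_zero]
  have hAc : ContDiffAt ℝ 2 A (ℓ 0) := by
    rw [map_zero]
    have h1 : ContDiffAt ℝ 2 (fun Φ : TDir 4 n M => fineAction (chart (ContinuousLinearMap.id ℝ (Matrix n n ℂ)) M U Φ) W) ((skewSub 4 n M).subtypeL 0) := by
      rw [map_zero]; exact contDiffAt_fineAction_chart (m := 2) (ContinuousLinearMap.id ℝ (Matrix n n ℂ)) M U W 0
    exact h1.comp 0 (skewSub 4 n M).subtypeL.contDiff.contDiffAt
  have hF := fderiv_fderiv_comp_clm ℓ hAc (1 : ℝ) 1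
  rw [map_zero, ContinuousLinearMap.toSpanSingleton_apply_one] at hF
  rw [← hF, fderiv_fderiv_one_one, hd2]

end

end Summit.QuantumFields.BalabanUV.T4Continuum.NE7SecondVariationHess
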